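import Summits.QuantumFields.GaugeBoot.Targets
import Mathlib.NumberTheory.Zsqrtd.GaussianInt
import Mathlib.GroupTheory.FreeGroup.Reduce
import HarnessLib

/-!
# A free subgroup of `SU(2)` with generators over `ℚ(i)`, kernel-checked; `FreeGroup ℕ ↪ SU(2)` (gauge-boot, large-`N` supplement 16, part 1)

HONEST FRAMING (cell `pub-gaugeboot`, page 1 of every file): the venture produces certified bounds
on lattice expectations at stated coupling, gauge group, dimension and torus size; NOT a mass gap,
NOT a continuum limit, NOT a string tension; NOT large `N` unless marked CONDITIONAL; NOT
Yang–Mills-summit-bearing (barriers `FixedCouplingUltralocality`, `PerturbativeInvisibility`).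
Pure group theory; this file certifies no number.  It supplies the algebraic kernel of
`NonBacktrackingHolonomy.lean` (supplement 16, part 2): a non-backtracking lattice loop is never
identically trivial over `SU(N)`, `N ≥ 2` — the fact the erratum of supplement 9
(`PlanarBootstrapLargeNRate.lean`, gen 86) argued in prose.

## Content

* `FreeSU2.genA = diag((3+4i)/5, (3−4i)/5)`, `FreeSU2.genB = [[3/5, 4/5], [−4/5, 3/5]]` — two elements of
  `SU 2` with entries in `ℚ(i)` (the unit quaternions `(3+4i)/5`, `(3+4j)/5`);
* ★★ `FreeSU2.prod_lval_ne_one` — **no non-empty reduced word in `A^{±1}, B^{±1}` is the identity**;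
  ★★ `FreeSU2.lift_gen_injective` — `FreeGroup (Fin 2) →* SU(2)`, `0 ↦ A`, `1 ↦ B`, is INJECTIVE:
  `SU(2)` contains a free subgroup of rank two with explicit rational generators;
* the countably infinite rank (`n ↦ A^{n+1} B A^{n+1}`, `FreeGroup ℕ ↪ SU(2)`) is `FreeSubgroupSU2Nat.lean`.

## Proof (Lubotzky–Phillips–Sarnak's integer quaternions of norm `5`, in matrix form)

`5A, 5A⁻¹, 5B, 5B⁻¹` are the Gaussian-integer matrices `gmat`; so `5^n · w(A,B)` is the integer matrix
product `∏ gmat`.  Reduce modulo the Gaussian prime `2 + i` (`redHom : ℤ[i] →+* 𝔽₅`, `i ↦ 3`): each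
reduced letter `rmat x` is a RANK-ONE matrix `u_x v_xᵀ` over `𝔽₅`, and `v_xᵀ u_y ≠ 0` unless `y = x⁻¹`
(`junction_ne_zero`, 12 cases by `decide`); hence the reduction of a reduced word is a non-zero multiple
of `u_{first} v_{last}ᵀ ≠ 0` (`prod_rmat_cons`), whereas `w(A,B) = 1` would make the integer product
`5^n · 1 ≡ 0 (mod 2+i)`.

[folklore] Hausdorff 1914 (free rotation groups); Lubotzky–Phillips–Sarnak, CPAM 39 (1986) S149 (the
norm-`5` quaternions `1+2i, 1+2j, 1+2k` generate a free group — our `A, B` are, up to sign, the squares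
of two of them); Tits 1972.  Mathlib supplies `FreeGroup.IsReduced`, `FreeGroup.toWord`, `ℤ[i]`,
`Zsqrtd.lift`; it has no free subgroup of a compact Lie group.
-/

noncomputable section

open Matrix GaussianInt

namespace Summit.QuantumFields.GaugeBoot

namespace FreeSU2

/-- Letters of words in two generators: `(0, true) = A`, `(0, false) = A⁻¹`, `(1, true) = B`,
`(1, false) = B⁻¹` (Mathlib's `FreeGroup` convention). [folklore] -/
abbrev Letter : Type := Fin 2 × Bool

/-! ## The Gaussian-integer matrices `5A^{±1}`, `5B^{±1}` and their reduction modulo `2 + i` -/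

/-- `gmat (0,true) = 5A = diag(3+4i, 3−4i)`, `gmat (0,false) = 5A⁻¹`, `gmat (1,true) = 5B = [[3,4],[−4,3]]`,
`gmat (1,false) = 5B⁻¹`, over `ℤ[i]`. [folklore] -/
def gmat (x : Letter) : Matrix (Fin 2) (Fin 2) GaussianInt :=
  if x.1 = 0 then (if x.2 then !![⟨3, 4⟩, 0; 0, ⟨3, -4⟩] else !![⟨3, -4⟩, 0; 0, ⟨3, 4⟩])
  else (if x.2 then !![3, 4; -4, 3] else !![3, -4; 4, 3])

/-- Reduction modulo the Gaussian prime `2 + i`: the ring homomorphism `ℤ[i] → 𝔽₅`, `i ↦ 3`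
(`3² = −1 (mod 5)`). [folklore] -/
def redHom : GaussianInt →+* ZMod 5 := Zsqrtd.lift ⟨3, by decide⟩

/-- The reduced letters `rmat x = gmat x (mod 2+i)` over `𝔽₅`. [folklore] -/
def rmat (x : Letter) : Matrix (Fin 2) (Fin 2) (ZMod 5) := (gmat x).map redHom

/-- Column vector of the rank-one factorisation `rmat x = u_x v_xᵀ`. [folklore] -/
def uvec (x : Letter) : Fin 2 → ZMod 5 :=
  if x.1 = 0 then (if x.2 then ![0, 1] else ![1, 0]) else (if x.2 then ![3, 1] else ![1, 3])

/-- Row vector of the rank-one factorisation `rmat x = u_x v_xᵀ`. [folklore] -/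
def vvec (x : Letter) : Fin 2 → ZMod 5 :=
  if x.1 = 0 then (if x.2 then ![0, 1] else ![1, 0]) else (if x.2 then ![1, 3] else ![3, 1])

/-- **Each reduced letter is rank one**: `rmat x = u_x v_xᵀ` (four `2 × 2` identities over `𝔽₅`). [folklore] -/
theorem rmat_eq_vecMulVec : ∀ x : Letter, rmat x = vecMulVec (uvec x) (vvec x) := by decide

/-- **Junctions do not vanish**: `v_xᵀ u_y ≠ 0` unless `y = x⁻¹` (twelve cases over `𝔽₅`). [folklore] -/
theorem junction_ne_zero : ∀ x y : Letter, (x.1 = y.1 → x.2 = y.2) → vvec x ⬝ᵥ uvec y ≠ 0 := by decide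

/-- A non-zero multiple of `u_x v_zᵀ` is a non-zero matrix. [folklore] -/
theorem smul_vecMulVec_uvec_vvec_ne_zero : ∀ (c : ZMod 5) (x z : Letter), c ≠ 0 → c • vecMulVec (uvec x) (vvec z) ≠ 0 := by
  decide

/-- `𝔽₅` has no zero divisors (by enumeration). [folklore] -/
theorem zmod5_mul_ne_zero : ∀ a b : ZMod 5, a ≠ 0 → b ≠ 0 → a * b ≠ 0 := by decide

/-- ★ **The rank-one chain.**  For a REDUCED word `x :: L`, the product of the reduced letters is a
NON-ZERO multiple of `u_x v_{last}ᵀ`. [folklore] -/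
theorem prod_rmat_cons (x : Letter) (L : List Letter) (h : FreeGroup.IsReduced (x :: L)) :
    ∃ c : ZMod 5, c ≠ 0 ∧ ((x :: L).map rmat).prod = c • vecMulVec (uvec x) (vvec ((x :: L).getLast (List.cons_ne_nil x L))) := by
  induction L generalizing x with
  | nil => exact ⟨1, by decide, by simp [rmat_eq_vecMulVec]⟩
  | cons y L ih =>
    obtain ⟨hxy, h'⟩ := FreeGroup.isReduced_cons_cons.1 h
    obtain ⟨c', hc', hprod⟩ := ih y h'
    refine ⟨c' * (vvec x ⬝ᵥ uvec y), zmod5_mul_ne_zero _ _ hc' (junction_ne_zero x y hxy), ?_⟩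
    rw [List.map_cons, List.prod_cons, hprod, rmat_eq_vecMulVec, Matrix.mul_smul, vecMulVec_mul_vecMulVec,
      vecMulVec_smul, smul_smul, List.getLast_cons_cons]

/-- ★ **A non-empty reduced word has non-zero reduction modulo `2 + i`.** [folklore] -/
theorem prod_rmat_ne_zero {L : List Letter} (hL : L ≠ []) (h : FreeGroup.IsReduced L) : (L.map rmat).prod ≠ 0 := by
  obtain ⟨x, L, rfl⟩ := List.exists_cons_of_ne_nil hL
  obtain ⟨c, hc, e⟩ := prod_rmat_cons x L h
  rw [e]
  exact smul_vecMulVec_uvec_vvec_ne_zero c x _ hc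

/-- The reduction of the integer product is the product of the reduced letters. [folklore] -/
theorem map_redHom_prod_gmat (L : List Letter) : ((L.map gmat).prod).map redHom = (L.map rmat).prod := by
  change RingHom.mapMatrix redHom (L.map gmat).prod = _
  rw [map_list_prod, List.map_map]
  rfl

/-! ## The complex side: `A, B ∈ SU(2)` -/

/-- The complex letters `cmat x = gmat x` read in `ℂ` (`= 5A^{±1}, 5B^{±1}`). [folklore] -/
def cmat (x : Letter) : Matrix (Fin 2) (Fin 2) ℂ := (gmat x).map GaussianInt.toComplex

/-- The complex reading of the integer product is the product of the complex letters. [folklore] -/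
theorem map_toComplex_prod_gmat (L : List Letter) : ((L.map gmat).prod).map GaussianInt.toComplex = (L.map cmat).prod := by
  change RingHom.mapMatrix GaussianInt.toComplex (L.map gmat).prod = _
  rw [map_list_prod, List.map_map]
  rfl

/-- **`A = diag((3+4i)/5, (3−4i)/5) ∈ SU(2)`** (the unit quaternion `(3+4i)/5`). [folklore] -/
def genA : SU 2 :=
  ⟨!![(⟨3/5, 4/5⟩ : ℂ), 0; 0, ⟨3/5, -4/5⟩], by
    rw [Matrix.mem_specialUnitaryGroup_iff, Matrix.mem_unitaryGroup_iff]
    refine ⟨?_, ?_⟩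
    · ext i j
      fin_cases i <;> fin_cases j <;>
        simp [Matrix.mul_apply, Fin.sum_univ_two, Matrix.star_apply, Complex.ext_iff] <;> norm_num
    · simp [Matrix.det_fin_two, Complex.ext_iff]; norm_num⟩

/-- **`B = [[3/5, 4/5], [−4/5, 3/5]] ∈ SU(2)`** (the unit quaternion `(3+4j)/5`). [folklore] -/
def genB : SU 2 :=
  ⟨!![(⟨3/5, 0⟩ : ℂ), ⟨4/5, 0⟩; ⟨-4/5, 0⟩, ⟨3/5, 0⟩], by
    rw [Matrix.mem_specialUnitaryGroup_iff, Matrix.mem_unitaryGroup_iff]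
    refine ⟨?_, ?_⟩
    · ext i j
      fin_cases i <;> fin_cases j <;>
        simp [Matrix.mul_apply, Fin.sum_univ_two, Matrix.star_apply, Complex.ext_iff] <;> norm_num
    · simp [Matrix.det_fin_two, Complex.ext_iff]; norm_num⟩

/-- The two generators as a family `Fin 2 → SU 2`. [folklore] -/
def gen : Fin 2 → SU 2 := ![genA, genB]

/-- The value of a letter: `gen i` or `(gen i)⁻¹` (Mathlib's `FreeGroup.lift` convention). [folklore] -/
def lval (x : Letter) : SU 2 := cond x.2 (gen x.1) (gen x.1)⁻¹

/-- In `SU(2)` the inverse is the conjugate transpose. [folklore] -/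
theorem coe_inv_eq_star (V : SU 2) : (V⁻¹).1 = star V.1 := rfl

/-- **`5 · (letter value) = the Gaussian-integer letter`**, for each of the four letters. [folklore] -/
theorem five_smul_lval (x : Letter) : (5 : ℂ) • (lval x).1 = cmat x := by
  obtain ⟨i, b⟩ := x
  fin_cases i <;> cases b <;>
    (ext j k
     fin_cases j <;> fin_cases k <;>
       simp [lval, gen, genA, genB, cmat, gmat, coe_inv_eq_star, Matrix.star_apply, Matrix.map_apply,
         GaussianInt.toComplex_def₂, Complex.ext_iff] <;> norm_num)

/-- `5^n · w(A,B) = ∏ cmat` for every word `w` of length `n` (no reducedness needed). [folklore] -/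
theorem pow_smul_prod_lval (L : List Letter) : (5 : ℂ) ^ L.length • ((L.map lval).prod).1 = (L.map cmat).prod := by
  induction L with
  | nil => simp
  | cons x L ih =>
    rw [List.map_cons, List.prod_cons, List.map_cons, List.prod_cons, List.length_cons, pow_succ', ← ih,
      ← five_smul_lval, Submonoid.coe_mul, Matrix.smul_mul, Matrix.mul_smul, smul_smul]

/-- `redHom 5 = 0`. [folklore] -/
theorem redHom_five : redHom 5 = 0 := by rw [map_ofNat]; decide

/-- ★★ **No non-empty reduced word in `A^{±1}, B^{±1}` is the identity of `SU(2)`.** [folklore] -/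
theorem prod_lval_ne_one {L : List Letter} (hL : L ≠ []) (h : FreeGroup.IsReduced L) : (L.map lval).prod ≠ 1 := by
  intro h1
  apply prod_rmat_ne_zero hL h
  have hC : (L.map cmat).prod = (5 : ℂ) ^ L.length • (1 : Matrix (Fin 2) (Fin 2) ℂ) := by
    rw [← pow_smul_prod_lval, h1, Submonoid.coe_one]
  rw [← map_toComplex_prod_gmat] at hC
  rw [← map_redHom_prod_gmat]
  have hn : L.length ≠ 0 := fun h0 => hL (List.eq_nil_of_length_eq_zero h0)
  ext i j
  have hij := congr_fun (congr_fun hC i) j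
  rw [Matrix.map_apply, Matrix.smul_apply, Matrix.one_apply] at hij
  rw [Matrix.map_apply, Matrix.zero_apply]
  by_cases h' : i = j
  · rw [if_pos h', smul_eq_mul, mul_one] at hij
    have h5 : ((L.map gmat).prod i j : GaussianInt) = 5 ^ L.length := by
      rw [← GaussianInt.toComplex_inj, hij, map_pow, map_ofNat]
    rw [h5, map_pow, redHom_five, zero_pow hn]
  · rw [if_neg h', smul_zero, GaussianInt.toComplex_eq_zero] at hij
    rw [hij, map_zero]

/-- ★★ **`SU(2)` contains a free group of rank two with rational generators**: the homomorphism
`FreeGroup (Fin 2) →* SU(2)`, `0 ↦ A = diag((3+4i)/5,(3−4i)/5)`, `1 ↦ B = [[3/5,4/5],[−4/5,3/5]]`, is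
injective. [folklore] -/
theorem lift_gen_injective : Function.Injective (FreeGroup.lift gen) := by
  rw [injective_iff_map_eq_one]
  intro g hg
  by_contra hne
  have hW : g.toWord ≠ [] := by rwa [Ne, FreeGroup.toWord_eq_nil_iff]
  have hlift := FreeGroup.lift_mk (f := gen) (L := g.toWord)
  rw [FreeGroup.mk_toWord, hg] at hlift
  exact prod_lval_ne_one hW FreeGroup.isReduced_toWord hlift.symm

end FreeSU2

end Summit.QuantumFields.GaugeBoot

end
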